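import Literature.Probability.LatticeModels.Sweep1
import Literature.Probability.RandomPlanarGeometry.ConformalMapProofs
import Literature.Probability.RandomPlanarGeometry.ConformalRectangleProofs
import Literature.Probability.LatticeModels.MedialInterfaceProofs
import Literature.Probability.LatticeModels.PairIdentities
import HarnessLib

/-!
# Smirnov's theorem on the FK-Ising fermion (crit-ising.S18): source audit and proof architecture

Sibling proof file of `Literature.Probability.LatticeModels.Sweep1`, opened for the discharge of
the named fact `Literature.Probability.LatticeModels.fkIsingObservable_tendstoLocallyUniformlyOn_sqrt_deriv`
(crit-ising.S18): the critical FK-Ising fermionic observable of the canonical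
`δℤ²`-discretisations `dobrushinData D δ` of a Dobrushin domain `(D; a, b)`, renormalised by
`δ^{-1/2}`, converges uniformly on compact subsets of `D` to `√Φ'` (up to lattice constant and
unit phases).

The printed source is S. Smirnov, *Conformal invariance in random cluster models. I. Holomorphic
fermions in the Ising model*, Ann. of Math. 172 (2010) 1435–1467 (arXiv:0708.0039; held in the
literature store as `paper:arxiv-0708.0039`, whose 18-page text rendering is quoted below by
page), **Theorem 2.2** (p. 5):

> Suppose that as the lattice mesh `δ_j` goes to zero, the discrete domains `Ω_j` on the lattices
> `δ_j ℤ²` (with points `a_j`, `b_j` on the boundary) converge to the domain `Ω` (with points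
> `a`, `b` on the boundary) **in the Carathéodory sense**. Then for the Ising model the
> functions `F_j = F(z, Ω_j, a_j, b_j, δ_j ℤ²)` converge uniformly away from the boundary:
> `δ_j^{-σ} F_j ⇉ (Φ')^σ`, `σ = 1/2`,

`Φ` mapping `Ω` onto the strip `ℝ × (0, 2)` with `a, b ↦ ∓∞`; Remark 2.3 (p. 5) defines
Carathéodory convergence of marked domains through normalised Riemann maps and records that
"Hausdorff convergence of the boundaries implies Carathéodory convergence".

## 1. Audit of the vendored statement (why this file does not simply prove S18)

`fkIsingObservable_tendstoLocallyUniformlyOn_sqrt_deriv` is *not* the printed theorem but a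
purported corollary of it: it hard-wires one discretisation scheme, G02's canonical data
`dobrushinData D δ = ⟨D, δ, (ab), (ba)⟩` (so `Ω_δ = meshDomain D δ`, the largest component of
`D ∩ δℤ²`, with discrete arcs cut out of `zdBoundary` by comparing distances to `(ab)` and
`(ba)`), under the sole hypothesis `∀ᶠ δ in 𝓝[>] 0, (dobrushinData D δ).IsZdAdmissible`.
Two facts about this rendering, both already on record in the tree for the companion statement
crit-ising.S17 (`Literature.Probability.LatticeModels.InterfaceSLE`, module docstring,
"Discretisations are quantified, not hard-wired", review r02345B item 1):

* for domains symmetric about the marked points the hypothesis fails at **every** mesh (a site of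
  `zdBoundary` equidistant from the two arcs lies in both discrete arcs, contradicting
  `IsZdAdmissible.disjoint`); in particular it fails for the tree's only closed-form Dobrushin
  domain `DobrushinDomain.unitDisc`, on which S18 is therefore vacuous;
* where the hypothesis does hold, deducing S18 from Theorem 2.2 consumes an *unprinted*
  property of `meshDomain`: that the face domains of `meshDomain D δ`, marked at the two `A`–`B`
  boundary edges `DiscreteDobrushin.zdABEdges`, converge to `(D; a, b)` in the Carathéodory
  sense as `δ → 0⁺` — for an arbitrary Jordan domain (H21's `JordanDomain` allows any Jordan
  curve, e.g. of positive area) this is not in the literature and is exactly the kind of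
  hypothesis Smirnov's theorem *assumes*.

For S17 the reviewed resolution was to quantify over CDHKS-type approximations
`E : ℝ → DiscreteDobrushin` with `IsDiscretisation D E` (canonical vertex set, arcs and discrete
marked points converging in Hausdorff distance, admissible for all small meshes). Part I below
vendors the **same rendering of Theorem 2.2** under a new name,
`fkIsingObservable_tendstoLocallyUniformlyOn_sqrt_deriv_of_isDiscretisation`, and proves that
S18 is *literally* this statement specialised to `E = dobrushinData D` plus one geometric input
on the canonical discretisation, isolated as an explicit hypothesis (not vendored as a fact,
since no source states it):

  `(GAP)  ∀ D, (∀ᶠ δ, (dobrushinData D δ).IsZdAdmissible) →`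
  `         hausdorffEDist (medialPoint δ '' (dobrushinData D δ).zdABEdges) {a, b} → 0 (δ → 0⁺)`,

i.e. the discrete marked points `a_δ, b_δ` of the canonical discretisation converge to `{a, b}`
(`fkIsingObservable_tendstoLocallyUniformlyOn_sqrt_deriv_of_tendsto_zdABEdges`; the other
four fields of `IsDiscretisation D (dobrushinData D)` hold by `rfl`/`hausdorffEDist_self`,
`isDiscretisation_dobrushinData`). One half of (GAP) — every `A`–`B` edge of an admissible
canonical discretisation lies within `o(1)` of `{a, b}` — is elementary (sites of `zdBoundary`
lie within `δ√2` of `∂D`; an `A`-site adjacent to a `B`-site is within `4δ` of both arcs; the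
arcs are compact and meet only at `a`, `b`); the other half — *each* of `a`, `b` has an `A`–`B`
edge nearby — appears to need accessibility of boundary points of Jordan domains (Schoenflies)
and a discrete boundary-chain argument, and is the open geometric debt recorded in the prover's
notes.

## 2. Architecture of the printed proof (the DAG behind Part II)

Smirnov's proof of Theorem 2.2 (§§3–5 with Appendices A–C, numbered §§6–8 in the arXiv text
rendering quoted here) has the following nodes; the H21 objects they speak about are indicated.

1. *s-holomorphicity* (Def. 3.1, Lemma 4.5, Rem. 4.6): the vertex observable
   `F(v) = E[χ_{v∈γ} W(γ, v)] cos(π/8)` (all passages counted; the display before Lemma 4.5)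
   has, at its 8 neighbouring edge and corner centres, the orthogonal projections of
   `F(v)` on the 8 lines `ℓ`; H21: `isSHolomorphic_fkIsingObservable` (named fact in
   `FermionicObservable`; H21's `fkIsingObservable` is Smirnov's `F(v)/cos(π/8)` up to the
   deterministic unit phase `exp(i W(γ, a→b)/2)` — winding measured from `e_a` instead of `b`,
   cf. the weight identity `W(γ, z) = exp(-(i/2) w(γ, b→z))` before Lemma 4.1).
2. *Discrete primitive* `H = Im ∫ F²` (Lemma 3.6, Rem. 3.7: `H(B) - H(W) = |F(e)|²` across the
   edge `e`; `2δ (H(v) - H(u)) = Im (F(z)² (v - u))` across the vertex `z`), *sub/super-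
   harmonicity* of its restrictions to black/white squares (Lemma 3.8, computations of §8) and
   constancy on boundary arcs for solutions of the discrete Riemann boundary value problem
   (Def. 3.4, Lemma 3.10). Needs (not in the tree): functions on the faces/vertices of the
   medial lattice, the diagonal discrete Laplacians.
3. *Boundary values* (Lemma 4.11): `F` solves the discrete RBVP, `H = 0` on `(ab)`, `H = 1` on
   `(ba)`.
4. *A priori estimate* (Lemma 4.8 ⇐ Appendix A, Lemma A.1 — "Lemma 6.1" in the numbering of
   the arXiv text rendering): `|H(B) - H(W)| ≤ P(e ∈ γ)² ≤ δ_r(δ)²` for edges `r`-away from one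
   of the arcs, from monotonicity (FKG comparison with `+` boundary conditions on a box) and
   the vanishing of the critical magnetisation (Kaufman–Onsager, Yang). Vendored below as the
   named fact `fkInterface_passageProb_le` (it is Ising-specific and independent of the rest).
5. *Discrete harmonic estimates* (Appendix B — "§7" of the arXiv text rendering, Lemmas
   B.1–B.4 = 7.1–7.4 there): Courant–Friedrichs–Lewy convergence of discrete harmonic functions
   and their difference quotients (B.1), the weak discrete Beurling estimate (B.2, Kesten 1987),
   convergence of the discrete harmonic measure of an arc under Carathéodory convergence (B.3),
   Verblunsky's interior gradient estimate, the McCrea–Whipple (1940) asymptotics of the planar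
   lattice Green function, and the Green-function gradient estimate (B.4). Needs (not in the
   tree): discrete Laplacian/harmonicity on `ℤ²`-domains, discrete Green functions of squares.
6. *Convergence of `H`* (Lemma 5.2): `H_j ⇉ Im Φ` away from `a, b`, from 2–5 by a sandwich
   between discrete harmonic majorant/minorant.
7. *Compactness* (Lemma 5.3: `δ_j ∑ |F_j|²` locally bounded, from subharmonicity, the discrete
   Riesz representation and B.4) and precompactness of `{F_j/√δ_j}` in the local uniform
   topology ("Theorem V.12.a" of a reference left unresolved by the text rendering —
   Lelong-Ferrand 1955 is the bibliography's monograph on the subject —, applied to primitives).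
8. *Identification* (end of §5): a subsequential limit `g` has `Im ∫ g² = Im Φ + const`, hence
   `g² = Φ'`.

Part II of this file is reserved for these nodes as they get stated against H21's objects and
proved; this first instalment vendors node 4 only. Part III is the normalisation glue for the
final assembly: the printed proof delivers the limit for *one* normalisation (one chordal map,
one sign of the square root; §5, "since `Φ` is uniquely defined up to a real additive constant,
its derivative, and hence the right hand side in [the display of Thm 2.2] are uniquely
determined", p. 11 of the arXiv text), and this
`∃ φ, ∃ g` form implies the quantified `∀ φ, ∀ g` form of the vendored statement, because
`ψ'/ψ` does not depend on the chordal map (`IsChordalUniformizing.exists_eq_trans_smul_holds`: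
chordal maps differ by a dilation of `ℍₒ`) and two holomorphic branches of `√(ψ'/ψ)` on the
connected set `D` differ by a global sign, absorbed in the phases `θ_δ`
(`fkIsingObservable_tendstoLocallyUniformlyOn_sqrt_deriv_of_isDiscretisation_of_exists`).

## 2b. Nodes 5–8 against H21's objects: the road actually needed (review-split, 2026-08-15)

Verdict of the review of this fact as a "split child" (source re-read: arXiv text pp. 4–15): it
is the corrected statement of S18, a published theorem, faithfully rendered, and is proved
INLINE by helper files (no further named facts; D-0026/D-0027). What the printed proof of §5 and
Appendix B consumes from "Carathéodory convergence" is available from `IsDiscretisation`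
directly: (K1) compacts of `D` are eventually covered by `Ω_δ = meshDomain D δ`, a single mesh
component — proved for every Jordan domain,
`JordanDomain.eventually_forall_mem_meshDomain'` (`MeshDomainJordan.lean`); (K2) boundary sites
lie within `3δ` of `∂D` (from `meshGraph`, `IsInnerFace`); (K3) eventually
`zdArcA ⊆ (D.arc 0)^{+r}`, `zdArcB ⊆ (D.arc 1)^{+r}` for every `r > 0` (fields `tendsto_arcA/B`,
the `infDist` comparison defining `zdDiscreteArc`, and K2); (K4) the two `A`–`B` edges are near
`{a, b}` (`tendsto_zdABEdges`). No Riemann-map convergence, Green function asymptotics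
(McCrea–Whipple, Lemma B.4), Harnack inequality, Lemma B.1 or Lelong-Ferrand precompactness is
needed; the following replaces them.

* G0 (combinatorics). (i) Arc connectivity `hA` and the constancy inputs `hcA`, `hcB` of
  `FKPrimitiveBounds` follow from admissibility, connectedness of `meshDomain` (K1) and
  `holeFree_innerFaces` (the boundary cycle of the face domain changes label exactly at the two
  `A`–`B` edges; filaments and pinches are excluded by `zdABEdges_inner`). (ii) `IsSHolomorphic`
  ⇒ discrete Cauchy–Riemann on every inner site and face (Rem. 3.3) ⇒ `F` restricted to the
  horizontal (resp. vertical) medial vertices is `latticeLaplacian`-harmonic on a translate of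
  `δℤ²` (sum the four CR identities around the vertex; the neighbour terms telescope — Duffin),
  and `F` at a vertical vertex is `Proj_{ℓ₁} F(z₁) + Proj_{ℓ₃} F(z₃)` for its two antipodal
  horizontal neighbours (orthogonal lines).
* G1 (discrete potential theory, on boxes of `ℤ²` only). (P1) the separable harmonic functions
  `sin(πk x₁/L) sinh(μ_k x₂)`, `cosh μ_k = 2 - cos(πk/L)`, and the discrete sine transform give
  the Poisson kernel of the box `Λ_L` explicitly; (P2) `c k/L ≤ μ_k ≤ πk/L` and
  `sinh a / sinh b ≤ e^{a-b}` give `HM_{Λ_L}(x, y) ≤ C/L` and `∑_y |HM(x+e, y) - HM(x, y)| ≤ C/L`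
  for `x ∈ Λ_{L/2}`, hence `|∇h| ≤ (C/L) max |h|` and `|h(x)| ≤ (C/L) (∑_{Λ_L} |h|²)^{1/2}` for
  lattice-harmonic `h`; (P3) `0 ≤ s ≤ 1` subharmonic on `Λ_{2L}` ⇒ `∑_{Λ_L} Δs ≤ C` (summation
  by parts against the ramp cutoff `ψ`, `∑ |Δψ| ≤ C`); (P4) `u = 0` off a finite `S` ⇒
  `∑_edges (∇u)² = -∑_S u Δu`.
* G2 (node 7 first: Lemma 5.3 with Lemma B.4 replaced by P3 + P4). On a box `9Q` (side
  `L = l/δ`) `r`-away from both arcs all corner fluxes are `≤ η := ρ_r(δ)²` (node 4: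
  `dartFlux_le_of_infDist`), so `|Hb f - Hw u| ≤ η` across corners and `|∇Hb|, |∇Hw| ≤ 2η`. With
  `HHb`, `HHw` the harmonic extensions of the boundary values of `Hb`, `Hw` on `9Q`
  (`exists_isLatticeHarmonicOn_eq_off`) the maximum principle on both lattices (site functions
  shifted by `(½,½)δ`) gives `Hb ≤ HHb ≤ shift HHw + η ≤ shift Hw + η ≤ Hb + η`, i.e.
  `0 ≤ HHb - Hb ≤ η` on `9Q` (no convergence of `H` is used). Then `u := HHb - Hb` has
  `∑ |∇u|² = ∑ u ΔHb ≤ η ∑_{9Q} ΔHb ≤ η C` (P4, P3 on `18Q`, `0 ≤ Hb ≤ 1` by `hb_mem_Icc`), so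
  `∑_Q |∇u| ≤ L √(ηC) = o(L)`, while `∑_Q |∇HHb| ≤ L² · C/L` (P2): `δ ∑_Q (|∇Hb| + |∇Hw|) = O(l)`
  and, the two jumps of `H` over a medial vertex being `Re` and `Im` of `κ F²`
  (`cornerFlux_sub_cornerFlux_eq_im`), `δ ∑_Q |F_δ|² ≤ C_Q`. By G0(ii) and P2 this `L²` bound
  yields `sup_{Q/2} |F_δ|/√δ ≤ C'_Q` and `|F_δ(z) - F_δ(z')|/√δ ≤ C''_Q |z - z'|`; Arzelà–Ascoli
  (`BoundedContinuousFunction.arzela_ascoli`, as in `Percolation/SmirnovContinuumLimit.lean`)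
  makes `F_δ(medialVertexAt δ ·)/√δ` sequentially precompact in the local uniform topology.
* G3 (node 6 and the boundary values). (B1) Along a convergent subsequence `F_δ/√δ → g` the
  primitives converge as well: `Hb_δ(z) - Hb_δ(z₀) = κ Im ∑ e^{iα_δ} (F_δ²/δ) Δv` along a lattice
  staircase (Rem. 3.7; `α_δ`, the frame phase of `E δ`, takes finitely many values) tends to
  `κ Im (e^{iα} ∫_{z₀}^{z} g²)`, and `Hb_δ(z₀) ∈ [0, 1]` (normalising `H_A = 0`), so on a further
  subsequence `Hb_δ, Hw_δ → h' = c + κ Im (e^{iα} Ψ)` locally uniformly, `Ψ` a local primitive of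
  `g²` (`DifferentiableOn.isExactOn_ball`): `h'` is harmonic with `0 ≤ h' ≤ 1`. (B2) `g` is
  holomorphic by Morera (`Complex.isConservativeOn_and_continuousOn_iff_isDifferentiableOn`):
  rectangle integrals of `g` are limits of discrete contour sums of `F_δ/√δ`, which vanish for CR
  functions. (B3) Boundary values (the content of Lemma B.3, for `H` itself): for `p` on the open
  arc approximated by `A` (where `Hw = H_A = 0`), `4r ≤ dist(p, other arc)` and `|z - p| ≤ ρ ≤ r`,
  the maximum principle for `Hb` on the interior faces inside `B(p, 2r)` (a non-interior inner
  face there corners an `A`-site by K3 and `exists_corner_mem_arcs_of_not_interiorFace`, where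
  `Hb = 0 + flux ≤ ρ_r(δ)²`, the dart being `2r`-away from `B`) gives
  `Hb_δ(z) ≤ ρ_r(δ)² + HM(z → faces near ∂B(p, 2r))`, and the **weak Beurling estimate** (P5)
  bounds that harmonic measure by `C (ρ/r)^β` uniformly in `δ ≤ δ₀(r)`: no closed path of inner
  faces inside `B(p, 2r)` surrounds `p` (closed inner faces lie in `D̄ = D ∪ ∂D`, the exterior of
  the Jordan curve being connected, unbounded and accumulating at `p`; discretise an exterior
  path on a finer nested lattice and apply `Percolation.exists_mem_support_of_crossing`), so in
  each dyadic square annulus about `p` the absorbed walk dies with probability `≥ c`, where `c` is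
  a product of eight "exit this rectangle through that side from a middle box" bounds, each
  bounded below by an explicit separable subsolution of P1 and the maximum principle
  (`μL ≤ π`), chained by the Markov property (path sums over `SRWStepSequences` /
  `SRWPathSpace`, or iterated harmonic-measure kernels); the four transversal strip crossings of
  the maneuver meet pairwise in the corner squares (crossing lemma) and would splice to a closed
  path around `p`. Symmetrically `Hw_δ ≥ 1 - ρ_r(δ)² - C(ρ/r)^β` near the other open arc, so
  `h' → 0`, resp. `1`, at every boundary point other than `a, b`. (B4) Uniqueness: for a chordal
  `φ` (`MarkedDomain.exists_isChordalUniformizing_holds`) and `ψ = φ.symm`, `h := π⁻¹ arg ψ` is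
  harmonic with the same boundary behaviour (boundary correspondence of `ChordalBoundary.lean`,
  `exists_tendsto_symm_of_mem_frontier`; `arg` is continuous on `{Im ≥ 0} ∖ {0}`), and
  `u := h' - h` (or `h' - (1 - h)`: `MarkedDomain` carries no orientation) is bounded harmonic and
  tends to `0` on `∂D ∖ {a, b}`; Lindelöf's maximum principle (`u ∓ ε (log (R/|z-a|) +
  log (R/|z-b|))`, harmonic functions being real parts of holomorphic ones on balls,
  `InnerProductSpace.HarmonicOnNhd.exists_analyticOnNhd_ball_re_eq`) gives `u = 0`.
* G4 (node 8 and assembly). `Im (e^{iα} κ Ψ) = ± π⁻¹ Im log ψ + const` on balls forces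
  `e^{iα} κ g² = ± π⁻¹ ψ'/ψ`, i.e. `g² = C⁻² · (unit) · ψ'/ψ` with `C` universal (`κ` traces back to
  `fluxConst = cos²(π/8)`, the mesh factor and `H_B - H_A = 1`, `jump_startCorner`). The unit and
  the branch sign go into `θ_δ := e^{iα_δ/2} ω_D ε_δ`, `ε_δ ∈ {±1}` chosen to minimise the
  sup-distance to a fixed branch of `√(ψ'/ψ)` on a compact exhaustion
  (`sqrtBranch_eqOn_or_eqOn_neg`); then every sequence `δ_n → 0⁺` has a subsequence along which
  `θ C F/√δ` converges to that branch, which is `TendstoLocallyUniformlyOn` along the countably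
  generated `𝓝[>] 0` (`Filter.tendsto_of_subseq_tendsto`), and
  `fkIsingObservable_tendstoLocallyUniformlyOn_sqrt_deriv_of_isDiscretisation_of_exists`
  finishes. Suggested order: P1–P2, G0(ii), G2, B1–B2, P5, B3, B4, G4; each instalment a proved
  file of its own.

## 3. Conventions

* `fkObservableOfData E z` extends `fkObservableAt D δ z` (which is the case
  `E = dobrushinData D δ`, `fkObservableOfData_dobrushinData`) to arbitrary discrete Dobrushin
  data, with the same junk value `0` for unbounded `Ω` or `δ ≤ 0` and the same `Fintype`
  structure `meshDomain_finite` (as in `fkDobrushinMeasure`).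
* As in S18, a universal lattice constant `C > 0` (outermost) and per-mesh unit phases `θ δ`
  absorb the differences between H21's observable and Smirnov's (`cos(π/8)`, the strip of width
  `2` versus `g² = ψ'/ψ`, the winding origin `e_a` versus `b`, the rotation making `e_b` point
  to the right, the sign of the square root, and the orientation `a ↔ b`, which changes `g` by
  the constant phase `±i`).

## References

* S. Smirnov, Ann. of Math. 172 (2010) 1435–1467, doi:10.4007/annals.2010.172.1435,
  arXiv:0708.0039 — bib key `Smirnov2010`.
* D. Chelkak, H. Duminil-Copin, C. Hongler, A. Kemppainen, S. Smirnov, C. R. Math. Acad. Sci.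
  Paris 352 (2014) 157–161 — bib key `CDHKSCRAS2014` (the `IsDiscretisation` rendering).
-/

noncomputable section

open MeasureTheory Filter Topology
open scoped NNReal ENNReal
open Literature.Probability.LatticeModels Literature.Probability.Percolation

namespace Literature.Probability.LatticeModels

/-! ## Part I. The printed theorem in the tree's rendering, and the reduction of S18 to it -/

open scoped Classical in
/-- The critical FK-Ising fermionic observable of arbitrary discrete Dobrushin data
`E = (Ω_δ; A, B)` read at the medial vertex closest to `z` (`medialVertexAt E.δ z`): G02's
`fkIsingObservable E p_c` (arc `A` wired, arc-`B` edges deleted, all passages counted, winding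
from `e_a`) for the `Fintype` structure `meshDomain_finite`; junk `0` if `Ω` is unbounded or
`δ ≤ 0`. For `E = dobrushinData D δ` this is `fkObservableAt D δ z` of `Sweep1`
(`fkObservableOfData_dobrushinData`). (Smirnov 2010, §2, the definition of `F` before
Prop. 2.1, and §4, the vertex observable `F(v)` before Lemma 4.5.)
[cite: Smirnov2010, §2 (definition of F before Prop. 2.1) and §4 (before Lemma 4.5)] -/
def fkObservableOfData (E : DiscreteDobrushin) (z : ℂ) : ℂ :=
  if h : Bornology.IsBounded E.Ω ∧ 0 < E.δ then
    haveI : Fintype (meshDomain E.Ω E.δ) := (meshDomain_finite h.1 h.2).fintype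
    fkIsingObservable E criticalFKIsingParam (medialVertexAt E.δ z)
  else 0

/-- On the canonical data `dobrushinData D δ` the observable of this file is the observable
`fkObservableAt D δ z` of crit-ising.S18 (same `Fintype` structure up to proof irrelevance, same
junk value for `δ ≤ 0`). [folklore] -/
theorem fkObservableOfData_dobrushinData (D : RandomPlanarGeometry.DobrushinDomain) (δ : ℝ) (z : ℂ) :
    fkObservableOfData (dobrushinData D δ) z = fkObservableAt D δ z := by
  unfold fkObservableOfData fkObservableAt
  by_cases hδ : 0 < δ
  · have h : Bornology.IsBounded (dobrushinData D δ).Ω ∧ 0 < (dobrushinData D δ).δ :=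
      ⟨D.isBounded, hδ⟩
    rw [dif_pos h, dif_pos hδ]
    rfl
  · have h : ¬ (Bornology.IsBounded (dobrushinData D δ).Ω ∧ 0 < (dobrushinData D δ).δ) :=
      fun h => hδ h.2
    rw [dif_neg h, dif_neg hδ]

/-- **Smirnov's theorem on the FK-Ising fermion, in the rendering of crit-ising.S17**
(Smirnov, Ann. of Math. 172 (2010) 1435, **Theorem 2.2**, with Remark 2.3 "Hausdorff
convergence of the boundaries implies Carathéodory convergence"; Chelkak–Smirnov, Invent. Math.
189 (2012) 515, Thm. A/B for the isoradial generalisation, not covered). There is a lattice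
constant `C > 0` such that: for every Dobrushin domain `(D; a, b)`, every family
`(Ω_δ; a_δ, b_δ) = E δ` of admissible square-lattice Dobrushin discretisations of it
(`IsDiscretisation D E`: `Ω_δ = meshDomain D δ`, arcs of the data converging to `(ab)`, `(ba)`
and discrete marked points `e_a, e_b` converging to `{a, b}` in Hausdorff distance, admissible
for all small `δ > 0`), every chordal uniformizing map `φ : (ℍ; 0, ∞) → (D; a, b)` with inverse
`ψ`, and every holomorphic branch `g` of `√(ψ'/ψ)` on `D` (`g = √π √Φ'` for the conformal map
`Φ = π⁻¹ log ψ` onto the strip of width `1`), there are unit complex numbers `θ_δ` such that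
`θ_δ · C · δ^{-1/2} · F_δ(z) → g(z)` as `δ → 0⁺`, uniformly on compact subsets of `D`, where
`F_δ = fkObservableOfData (E δ)` is the critical FK-Ising fermionic observable of `E δ` at the
medial vertex closest to `z`. The printed hypothesis is Carathéodory convergence of arbitrary
discrete Dobrushin domains `(Ω_j; a_j, b_j) → (Ω; a, b)`; `IsDiscretisation` is the tree's
(CDHKS 2014, §1) Hausdorff-type approximation on the canonical vertex set, as for
`convergesInLawToSLE_sixteen_thirds_fkInterface`. **Relation to crit-ising.S18:**
`fkIsingObservable_tendstoLocallyUniformlyOn_sqrt_deriv` is this statement for the single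
family `E = dobrushinData D`, whose `IsDiscretisation` property reduces to the convergence of
its discrete marked points (`isDiscretisation_dobrushinData`,
`fkIsingObservable_tendstoLocallyUniformlyOn_sqrt_deriv_of_tendsto_zdABEdges`); S18's
hypothesis fails at every mesh for domains symmetric about `a, b` (e.g.
`DobrushinDomain.unitDisc`), which is why the quantified form is recorded separately.
[cite: Smirnov2010, Thm 2.2 and Rem. 2.3] -/
def fkIsingObservable_tendstoLocallyUniformlyOn_sqrt_deriv_of_isDiscretisation : Prop :=
  ∃ C : ℝ, 0 < C ∧ ∀ (D : RandomPlanarGeometry.DobrushinDomain) (E : ℝ → DiscreteDobrushin), IsDiscretisation D E →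
      ∀ (φ : RandomPlanarGeometry.ConformalEquiv UpperHalfPlane.upperHalfPlaneSet D.carrier),
        D.IsChordalUniformizing φ →
      ∀ g : ℂ → ℂ, DifferentiableOn ℂ g D.carrier →
        (∀ z ∈ D.carrier, g z ^ 2 = deriv φ.symm z / φ.symm z) →
        ∃ θ : ℝ → ℂ, (∀ δ, ‖θ δ‖ = 1) ∧
          TendstoLocallyUniformlyOn
            (fun δ z => θ δ * C * ((δ ^ (-(1 / 2 : ℝ)) : ℝ) : ℂ) * fkObservableOfData (E δ) z) g
            (𝓝[>] (0 : ℝ)) D.carrier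

/-- The canonical data `dobrushinData D` form an `IsDiscretisation` family of `(D; a, b)` as
soon as they are admissible for all small meshes and their discrete marked points (the
midpoints of the two `A`–`B` boundary edges) converge to `{a, b}`: the domain and mesh fields
hold by `rfl` and the arcs of the data *are* `(ab)`, `(ba)` (`hausdorffEDist_self`).
(CDHKS 2014, §1, for the notion; elementary.) [folklore] -/
theorem isDiscretisation_dobrushinData {D : RandomPlanarGeometry.DobrushinDomain}
    (hadm : ∀ᶠ δ in 𝓝[>] (0 : ℝ), (dobrushinData D δ).IsZdAdmissible)
    (hab : Tendsto (fun δ : ℝ => Metric.hausdorffEDist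
        (medialPoint δ '' (dobrushinData D δ).zdABEdges) {D.pt 0, D.pt 1}) (𝓝[>] 0) (𝓝 0)) :
    IsDiscretisation D (dobrushinData D) where
  Ω_eq _ := rfl
  δ_eq _ := rfl
  tendsto_arcA := by
    simp only [dobrushinData_arcA, Metric.hausdorffEDist_self]
    exact tendsto_const_nhds
  tendsto_arcB := by
    simp only [dobrushinData_arcB, Metric.hausdorffEDist_self]
    exact tendsto_const_nhds
  tendsto_zdABEdges := hab
  eventually_isZdAdmissible := hadm

/-- Conversely, an `IsDiscretisation` family equal to the canonical data has convergent
discrete marked points and is eventually admissible (the two non-trivial fields), so that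
`isDiscretisation_dobrushinData` is sharp. [folklore] -/
theorem IsDiscretisation.dobrushinData_iff (D : RandomPlanarGeometry.DobrushinDomain) :
    IsDiscretisation D (dobrushinData D) ↔
      (∀ᶠ δ in 𝓝[>] (0 : ℝ), (dobrushinData D δ).IsZdAdmissible) ∧
        Tendsto (fun δ : ℝ => Metric.hausdorffEDist
          (medialPoint δ '' (dobrushinData D δ).zdABEdges) {D.pt 0, D.pt 1}) (𝓝[>] 0) (𝓝 0) :=
  ⟨fun h => ⟨h.eventually_isZdAdmissible, h.tendsto_zdABEdges⟩,
    fun h => isDiscretisation_dobrushinData h.1 h.2⟩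

-- names the `@[deprecated]` record `fkIsingObservable_tendstoLocallyUniformlyOn_sqrt_deriv` of `Sweep1.lean` on
-- purpose: this IS its reduction to the corrected statement (verdict clean-up 2026-08-15); REMOVE-WHEN the record is
-- deleted from `Sweep1.lean` (or spell its statement out as the conclusion here)
set_option linter.deprecated false in
/-- **Reduction of crit-ising.S18 to the printed theorem.** Smirnov's Theorem 2.2 in the
`IsDiscretisation` rendering (`fkIsingObservable_tendstoLocallyUniformlyOn_sqrt_deriv_of_
isDiscretisation`), together with the geometric input (GAP) of the module docstring — for
eventually admissible canonical discretisations the discrete marked points `a_δ, b_δ` converge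
to `{a, b}` — yields `fkIsingObservable_tendstoLocallyUniformlyOn_sqrt_deriv` verbatim, with the
same constant and phases: S18 *is* the quantified statement at `E = dobrushinData D`
(`fkObservableOfData_dobrushinData`). (GAP) is a hypothesis here, not a vendored fact: no source
states it for H21's `meshDomain`. [folklore] -/
theorem fkIsingObservable_tendstoLocallyUniformlyOn_sqrt_deriv_of_tendsto_zdABEdges
    (h₁ : fkIsingObservable_tendstoLocallyUniformlyOn_sqrt_deriv_of_isDiscretisation)
    (h₂ : ∀ D : RandomPlanarGeometry.DobrushinDomain, (∀ᶠ δ in 𝓝[>] (0 : ℝ), (dobrushinData D δ).IsZdAdmissible) →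
      Tendsto (fun δ : ℝ => Metric.hausdorffEDist
        (medialPoint δ '' (dobrushinData D δ).zdABEdges) {D.pt 0, D.pt 1}) (𝓝[>] 0) (𝓝 0)) :
    fkIsingObservable_tendstoLocallyUniformlyOn_sqrt_deriv := by
  obtain ⟨C, hC, h⟩ := h₁
  refine ⟨C, hC, fun D hadm φ hφ g hg hg2 => ?_⟩
  obtain ⟨θ, hθ, hlim⟩ :=
    h D (dobrushinData D) (isDiscretisation_dobrushinData hadm (h₂ D hadm)) φ hφ g hg hg2
  refine ⟨θ, hθ, hlim.congr fun δ z _ => ?_⟩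
  simp only [fkObservableOfData_dobrushinData]

/-! ## Part II. Inputs of the printed proof

### Node 4: the a priori estimate (Smirnov 2010, Appendix A, Lemma A.1 ⇒ Lemma 4.8) -/

/-- **A priori estimate: the FK-Ising interface is not space-filling** (Smirnov, Ann. of Math.
172 (2010), Appendix A, **Lemma A.1** — "Lemma 6.1" in the numbering of the arXiv text
rendering —, the input of Lemma 4.8; proof there: FKG/monotonicity
comparison with `+` boundary conditions on a box of side `r/2` and the vanishing of the critical
magnetisation, Kaufman–Onsager 1949 / Yang 1952, self-duality for the other arc). For every
`r > 0` there is a function `ρ_r` with `ρ_r(δ) → 0` as `δ → 0⁺` such that, for all admissible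
discrete Dobrushin data `E = (Ω_δ; A, B)` on `δℤ²` discretising a Jordan domain
(`E.Ω = D.carrier`; print's standing assumption, §3, is that the lattice domains are simply
connected) and every edge `z` of `Ω_δ` (medial vertex) at Euclidean distance at least `r` from
the discrete arc `A` or from the discrete arc `B`, the probability under the critical FK-Ising
Dobrushin measure `fkDobrushinMeasure E` (arc `A` wired, arc-`B` edges deleted) that the FK
interface `fkInterface E ω` passes through `z` is at most `ρ_r(δ)`. The function `ρ_r` depends
on `r` only ("the only way the shape of `Ω` enters into the estimate is via `r`", Rem. 4.9).
Print measures distances in the inner metric of the domain, which is at least the Euclidean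
one, so this rendering asks more of `z` and is implied by the printed lemma. [cite: Smirnov2010, Appendix A Lemma A.1 (arXiv: Lemma 6.1); Lemma 4.8, Rem. 4.9] -/
def fkInterface_passageProb_le : Prop :=
  ∀ r : ℝ, 0 < r → ∃ ρ : ℝ → ℝ, Tendsto ρ (𝓝[>] (0 : ℝ)) (𝓝 0) ∧
    ∀ (D : RandomPlanarGeometry.JordanDomain) (E : DiscreteDobrushin), E.Ω = D.carrier → E.IsZdAdmissible →
      ∀ z : MedialVertex, z ∈ (discreteDomainGraph E.Ω E.δ).edgeSet →
        (r ≤ Metric.infDist (medialPoint E.δ z) (meshPoint E.δ '' E.zdArcA) ∨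
          r ≤ Metric.infDist (medialPoint E.δ z) (meshPoint E.δ '' E.zdArcB)) →
        (fkDobrushinMeasure E).real {ω | z ∈ fkInterface E ω} ≤ ρ E.δ

/-! ## Part III. Normalisation glue for the assembly: the `∃ φ, ∃ g` form suffices

The vendored statement quantifies over *every* chordal uniformizing map `φ` of `(D; a, b)` and
*every* holomorphic branch `g` of `√(ψ'/ψ)`, `ψ = φ⁻¹`, whereas the printed proof (§5) produces
the limit for one normalisation. The two forms are equivalent: chordal uniformizing maps differ
by a dilation `z ↦ c z` (`c > 0`) of `ℍₒ` (`IsChordalUniformizing.exists_eq_trans_smul_holds`,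
proved in the tree from Schwarz's lemma and Carathéodory's theorem), which replaces `ψ` by
`c⁻¹ ψ` and leaves `ψ'/ψ` unchanged; and two holomorphic branches of the square root of the
non-vanishing function `ψ'/ψ` on the connected open set `D` differ by a global sign
(`IsPreconnected.eq_or_eq_neg_of_sq_eq`), which the unit phases `θ_δ` absorb. -/

section NormalisationGlue

open Literature.Probability.RandomPlanarGeometry

variable {D : RandomPlanarGeometry.DobrushinDomain}

/-- For a conformal equivalence `φ : ℍₒ → D` and `z ∈ D`, the logarithmic derivative
`ψ'(z)/ψ(z)` of `ψ = φ⁻¹` does not vanish: `ψ z ∈ ℍₒ` is non-zero and `ψ'(z) ≠ 0`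
(`ConformalEquiv.deriv_symm_ne_zero`; Ahlfors, *Complex Analysis* (1979), Ch. 4 §3.3 Cor. 2). [folklore] -/
theorem deriv_symm_div_symm_ne_zero
    (φ : RandomPlanarGeometry.ConformalEquiv UpperHalfPlane.upperHalfPlaneSet D.carrier)
    {z : ℂ} (hz : z ∈ D.carrier) : deriv φ.symm z / φ.symm z ≠ 0 := by
  have h1 : φ.symm z ∈ UpperHalfPlane.upperHalfPlaneSet := φ.symm_mapsTo hz
  have h2 : φ.symm z ≠ 0 := by
    intro h0
    have h3 : (0 : ℝ) < (φ.symm z).im := h1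
    rw [h0, Complex.zero_im] at h3
    exact lt_irrefl 0 h3
  exact div_ne_zero (φ.deriv_symm_ne_zero UpperHalfPlane.isOpen_upperHalfPlaneSet hz) h2

/-- **The logarithmic derivative of the inverse chordal map does not depend on the chordal map.**
Two chordal uniformizing maps `φ, φ'` of `(D; a, b)` satisfy `φ' = φ ∘ (c • ·)` on `ℍₒ` for some
`c > 0` (`IsChordalUniformizing.exists_eq_trans_smul_holds`), hence `φ'⁻¹ = c⁻¹ φ⁻¹` on `D` and
`(φ'⁻¹)'/φ'⁻¹ = (φ⁻¹)'/φ⁻¹` there (Smirnov 2010, §5, before Remark 5.1: "since `Φ` is uniquely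
defined up to a real additive constant, its derivative [is] uniquely determined"). [cite: Smirnov2010, §5 (paragraph before Remark 5.1)] -/
theorem deriv_symm_div_symm_eq_of_isChordalUniformizing
    {φ φ' : RandomPlanarGeometry.ConformalEquiv UpperHalfPlane.upperHalfPlaneSet D.carrier}
    (hφ : D.IsChordalUniformizing φ) (hφ' : D.IsChordalUniformizing φ') {z : ℂ}
    (hz : z ∈ D.carrier) : deriv φ'.symm z / φ'.symm z = deriv φ.symm z / φ.symm z := by
  obtain ⟨c, hc, heq⟩ := MarkedDomain.IsChordalUniformizing.exists_eq_trans_smul_holds hφ hφ'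
  -- `φ'⁻¹ = c⁻¹ • φ⁻¹` on `D`
  have hsymm : ∀ w ∈ D.carrier, φ'.symm w = (c⁻¹ : ℝ) • φ.symm w := by
    intro w hw
    have hw1 : φ.symm w ∈ UpperHalfPlane.upperHalfPlaneSet := φ.symm_mapsTo hw
    have hw2 : (c⁻¹ : ℝ) • φ.symm w ∈ UpperHalfPlane.upperHalfPlaneSet :=
      (ConformalEquiv.smulUpperHalfPlane c⁻¹ (inv_pos.2 hc)).mapsTo hw1
    have h3 : φ' ((c⁻¹ : ℝ) • φ.symm w) = w := by
      rw [heq hw2, ConformalEquiv.trans_apply, ConformalEquiv.smulUpperHalfPlane_apply, smul_smul,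
        mul_inv_cancel₀ hc.ne', one_smul, φ.apply_symm_apply hw]
    have h4 := congrArg φ'.symm h3
    rw [φ'.symm_apply_apply hw2] at h4
    exact h4.symm
  have hderiv : deriv φ'.symm z = (c⁻¹ : ℝ) • deriv φ.symm z := by
    have hev : (φ'.symm : ℂ → ℂ) =ᶠ[𝓝 z] fun w => (c⁻¹ : ℝ) • φ.symm w :=
      Filter.eventuallyEq_of_mem (D.isOpen.mem_nhds hz) fun w hw => hsymm w hw
    rw [hev.deriv_eq, deriv_fun_const_smul]
    exact (φ.symm.differentiableOn_coe z hz).differentiableAt (D.isOpen.mem_nhds hz)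
  have hc' : ((c⁻¹ : ℝ) : ℂ) ≠ 0 := Complex.ofReal_ne_zero.2 (inv_pos.2 hc).ne'
  rw [hderiv, hsymm z hz, Complex.real_smul, Complex.real_smul, mul_div_mul_left _ _ hc']

/-- **Two holomorphic branches of `√(ψ'/ψ)` on `D` agree up to a global sign**: `D` is connected
and `ψ'/ψ` does not vanish (`deriv_symm_div_symm_ne_zero`), so `g'/g` is continuous with values
in `{±1}`, hence constant (Mathlib's `IsPreconnected.eq_or_eq_neg_of_sq_eq`). [folklore] -/
theorem sqrtBranch_eqOn_or_eqOn_neg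
    (φ : RandomPlanarGeometry.ConformalEquiv UpperHalfPlane.upperHalfPlaneSet D.carrier)
    {g g' : ℂ → ℂ} (hg : DifferentiableOn ℂ g D.carrier) (hg' : DifferentiableOn ℂ g' D.carrier)
    (hg2 : ∀ z ∈ D.carrier, g z ^ 2 = deriv φ.symm z / φ.symm z)
    (hg'2 : ∀ z ∈ D.carrier, g' z ^ 2 = deriv φ.symm z / φ.symm z) :
    Set.EqOn g' g D.carrier ∨ Set.EqOn g' (-g) D.carrier := by
  refine D.isConnected.isPreconnected.eq_or_eq_neg_of_sq_eq hg'.continuousOn hg.continuousOn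
    (fun z hz => ?_) (fun {z} hz h0 => ?_)
  · simp only [Pi.pow_apply, hg2 z hz, hg'2 z hz]
  · have h1 := hg2 z hz
    rw [h0, zero_pow two_ne_zero] at h1
    exact deriv_symm_div_symm_ne_zero φ hz h1.symm

/-- **The `∃ φ, ∃ g` form of Smirnov's theorem suffices.** If, with a universal lattice constant
`C > 0`, for every Dobrushin domain `(D; a, b)` and every `IsDiscretisation` family `E` the
renormalised observables `θ_δ C δ^{-1/2} F_δ` converge locally uniformly on `D` to *some*
holomorphic branch `g` of `√(ψ'/ψ)` for *some* chordal uniformizing map `φ` — the form the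
printed proof delivers (Smirnov 2010, §5: one map `Φ` onto the strip, one square root) —, then
`fkIsingObservable_tendstoLocallyUniformlyOn_sqrt_deriv_of_isDiscretisation` holds as stated,
for all chordal maps and all branches: `ψ'/ψ` does not depend on `φ`
(`deriv_symm_div_symm_eq_of_isChordalUniformizing`), and the other branch `-g` is reached by
replacing the unit phases `θ_δ` by `-θ_δ` (`sqrtBranch_eqOn_or_eqOn_neg`). [cite: Smirnov2010, Thm 2.2 with §5 (paragraph before Remark 5.1)] -/
theorem fkIsingObservable_tendstoLocallyUniformlyOn_sqrt_deriv_of_isDiscretisation_of_exists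
    (h : ∃ C : ℝ, 0 < C ∧ ∀ (D : RandomPlanarGeometry.DobrushinDomain) (E : ℝ → DiscreteDobrushin),
      IsDiscretisation D E →
      ∃ φ : RandomPlanarGeometry.ConformalEquiv UpperHalfPlane.upperHalfPlaneSet D.carrier,
        D.IsChordalUniformizing φ ∧
      ∃ g : ℂ → ℂ, DifferentiableOn ℂ g D.carrier ∧
        (∀ z ∈ D.carrier, g z ^ 2 = deriv φ.symm z / φ.symm z) ∧
        ∃ θ : ℝ → ℂ, (∀ δ, ‖θ δ‖ = 1) ∧
          TendstoLocallyUniformlyOn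
            (fun δ z => θ δ * C * ((δ ^ (-(1 / 2 : ℝ)) : ℝ) : ℂ) * fkObservableOfData (E δ) z) g
            (𝓝[>] (0 : ℝ)) D.carrier) :
    fkIsingObservable_tendstoLocallyUniformlyOn_sqrt_deriv_of_isDiscretisation := by
  obtain ⟨C, hC, h⟩ := h
  refine ⟨C, hC, fun D E hE φ' hφ' g' hg' hg'2 => ?_⟩
  obtain ⟨φ, hφ, g, hg, hg2, θ, hθ, hlim⟩ := h D E hE
  have hg'2φ : ∀ z ∈ D.carrier, g' z ^ 2 = deriv φ.symm z / φ.symm z := fun z hz =>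
    (hg'2 z hz).trans (deriv_symm_div_symm_eq_of_isChordalUniformizing hφ hφ' hz)
  rcases sqrtBranch_eqOn_or_eqOn_neg φ hg hg' hg2 hg'2φ with heq | heq
  · exact ⟨θ, hθ, hlim.congr_right heq.symm⟩
  · refine ⟨fun δ => -θ δ, fun δ => by rw [norm_neg, hθ], ?_⟩
    have h2 := uniformContinuous_neg.comp_tendstoLocallyUniformlyOn hlim
    refine (h2.congr fun δ z _ => ?_).congr_right fun z hz => ?_
    · simp only [Function.comp_apply, neg_mul]
    · rw [Function.comp_apply, heq hz, Pi.neg_apply]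

end NormalisationGlue

end Literature.Probability.LatticeModels

/-! ## Appendix A (literature-prover, 2026-08-15): node 4, step 1 — an interface edge carries a
primal arm to the wired arc and a dual arm to the free arc

First input of the printed proof of `fkInterface_passageProb_le` (Smirnov 2010, Appendix A,
proof of Lemma A.1, first sentence: "If an edge `e` belongs to the interface, then `B` is connected
by a cluster to the arc `ba` and `W` — by a dual cluster to the arc `ab` (since the interface
separates the two)"), proved for H21's interface `fkInterface E ω` = the cut orbit of the
successor map `nextCorner` from the start corner (`MedialInterfaceProofs`:
`IsMedialExploration.eq_explorationList`). Along the orbit the left vertex moves only along open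
edges of the completed configuration `E.bcBondConfig ω` (`cornerOrbit_fst_reachable` of
`PairIdentities`) and the face
changes only across closed edges, whose dual edges are dual-open (`dualEdge_cTgt`,
`reachable_cFace_cornerOrbit`); the source edge `e_a` of the start corner is closed, so the outer
face at `e_a` (not an inner face, with a corner on the discrete arc `B`) belongs to the same dual
cluster (`reachable_outerFace_cFace_cornerOrbit`). Consequences for an edge `z` of the interface:
`exists_reachable_zdArcA_of_mem_fkInterface` (an endpoint of `z` lies in the `bcBondConfig`-open
cluster of the arc `A`) and `exists_dualReachable_of_mem_fkInterface` (a face bordered by `z` lies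
in the dual-open cluster of the outer face at `e_a`). Everything here is deterministic (every `ω`);
the probabilistic steps of Lemma A.1 (comparison of boundary conditions, magnetisation) are the
remaining nodes recorded in the module docstring, §2, item 4.
-/

namespace Literature.Probability.LatticeModels

open SimpleGraph

section Arms

variable {E : DiscreteDobrushin} {ω : Percolation.BondConfig (Site 2)} {c₀ : Site 2 × Fin 4}

local notation "orb" => cornerOrbit (E.bcBondConfig ω) c₀

/-- The dual edge of the target edge `s(x, x + cornerUnit (k + 1))` of the coded corner `(x, k)`
joins its face `faceAt x k` to the next face `faceAt x (k + 1)` counter-clockwise around `x`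
(lower-left-corner indexing of faces, as in `dualEdge`); four-case coordinate check (H21 index
bookkeeping). [folklore] -/
theorem dualEdge_cTgt (p : Site 2 × Fin 4) :
    Percolation.dualEdge (cTgt p) = s(faceAt p.1 p.2, faceAt p.1 (p.2 + 1)) := by
  obtain ⟨x, k⟩ := p
  have h1 : s(x, x + -(Pi.single 0 1 : Site 2)) =
      s(x - Pi.single 0 1, x - Pi.single 0 1 + Pi.single 0 1) := by
    rw [sub_add_cancel, Sym2.eq_swap, sub_eq_add_neg]
  have h2 : s(x, x + -(Pi.single 1 1 : Site 2)) =
      s(x - Pi.single 1 1, x - Pi.single 1 1 + Pi.single 1 1) := by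
    rw [sub_add_cancel, Sym2.eq_swap, sub_eq_add_neg]
  have l0 : Percolation.dualEdge (cTgt (x, 0)) = s(faceAt x 0, faceAt x (0 + 1)) := by
    have hu : cornerUnit ((0 : Fin 4) + 1) = Pi.single 1 1 := by decide
    have ho : cornerOff ((0 : Fin 4) + 1) = Pi.single 0 1 := by decide
    have ho' : cornerOff (0 : Fin 4) = 0 := by decide
    simp only [cTgt, faceAt, hu, ho, ho', sub_zero, Percolation.dualEdge_vertical, Sym2.eq_swap]
  have l1 : Percolation.dualEdge (cTgt (x, 1)) = s(faceAt x 1, faceAt x (1 + 1)) := by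
    have hu : cornerUnit ((1 : Fin 4) + 1) = -Pi.single 0 1 := by decide
    have ho : cornerOff ((1 : Fin 4) + 1) = Pi.single 0 1 + Pi.single 1 1 := by decide
    have ho' : cornerOff (1 : Fin 4) = Pi.single 0 1 := by decide
    simp only [cTgt, faceAt, hu, ho, ho']
    rw [h1, Percolation.dualEdge_horizontal, Sym2.eq_swap, sub_add_eq_sub_sub]
  have l2 : Percolation.dualEdge (cTgt (x, 2)) = s(faceAt x 2, faceAt x (2 + 1)) := by
    have hu : cornerUnit ((2 : Fin 4) + 1) = -Pi.single 1 1 := by decide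
    have ho : cornerOff ((2 : Fin 4) + 1) = Pi.single 1 1 := by decide
    have ho' : cornerOff (2 : Fin 4) = Pi.single 0 1 + Pi.single 1 1 := by decide
    simp only [cTgt, faceAt, hu, ho, ho']
    rw [h2, Percolation.dualEdge_vertical, sub_add_eq_sub_sub, sub_right_comm]
  have l3 : Percolation.dualEdge (cTgt (x, 3)) = s(faceAt x 3, faceAt x (3 + 1)) := by
    have hu : cornerUnit ((3 : Fin 4) + 1) = Pi.single 0 1 := by decide
    have ho : cornerOff ((3 : Fin 4) + 1) = 0 := by decide
    have ho' : cornerOff (3 : Fin 4) = Pi.single 1 1 := by decide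
    simp only [cTgt, faceAt, hu, ho, ho', sub_zero]
    rw [Percolation.dualEdge_horizontal]
  fin_cases k
  · exact l0
  · exact l1
  · exact l2
  · exact l3

/-- `k ≠ k + 1` in `Fin 4`. [folklore] -/
theorem fin4_ne_add_one (k : Fin 4) : k ≠ k + 1 := by revert k; decide

/-- Along the orbit the face only ever changes across a closed edge of the completed configuration,
whose dual edge is dual-open and joins the two faces: every orbit face is joined to the start face
by dual-open dual edges. (Smirnov 2010, Appendix A, proof of Lemma A.1: "… and [the square on the
other side] by a dual cluster to the [free] arc"; Smirnov 2001, §2.)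
[cite: Smirnov2010, Appendix A, proof of Lemma A.1] -/
theorem reachable_cFace_cornerOrbit (n : ℕ) :
    (Percolation.openGraph (Percolation.dualConfig (E.bcBondConfig ω))).Reachable
      (cFace c₀) (cFace (orb n)) := by
  induction n with
  | zero => exact Reachable.refl _
  | succ n ih =>
    by_cases h : cTgt (orb n) ∈ E.bcBondConfig ω
    · rw [cornerOrbit_succ, cFace_nextCorner_of_mem h]
      exact ih
    · rw [cornerOrbit_succ, cFace_nextCorner_of_not_mem h]
      refine ih.trans (Adj.reachable ?_)
      rw [Percolation.openGraph_adj]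
      refine ⟨?_, fun heq => fin4_ne_add_one _ (faceAt_injective _ heq)⟩
      have := DiscreteDobrushin.dualEdge_mem_dualConfig_of_not_mem (cTgt_mem_edgeSet (orb n)) h
      rwa [dualEdge_cTgt] at this

/-- For a start corner of admissible data, the *outer* face at the `A`–`B` edge `e_a` (the
non-inner face `faceAt x (k + 3)` on the other side of the source edge of the start corner
`(x, k)`) is joined by dual-open dual edges to every orbit face: `e_a` is closed, so its dual edge
is dual-open. [cite: Smirnov2010, Appendix A, proof of Lemma A.1] -/
theorem reachable_outerFace_cFace_cornerOrbit (hE : E.IsZdAdmissible) (hc₀ : E.IsStartCorner c₀)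
    (n : ℕ) :
    (Percolation.openGraph (Percolation.dualConfig (E.bcBondConfig ω))).Reachable
      (faceAt c₀.1 (c₀.2 + 3)) (cFace (orb n)) := by
  refine (Adj.reachable ?_).trans (reachable_cFace_cornerOrbit n)
  rw [Percolation.openGraph_adj]
  refine ⟨?_, fun heq => fin4_add_three_ne _ (faceAt_injective _ heq)⟩
  have := DiscreteDobrushin.dualEdge_mem_dualConfig_of_not_mem (cSrc_mem_edgeSet c₀)
    (cSrc_start_not_mem (ω := ω) hE hc₀)
  rwa [← cTgt_crossPred c₀, dualEdge_cTgt, fin4_add_three_add_one] at this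

/-- **An edge of the FK interface has an endpoint in the open cluster of the wired arc.** For
admissible Dobrushin data and every configuration `ω`, if the medial vertex (lattice edge) `z`
lies on the FK interface `fkInterface E ω`, then one of its endpoints is joined to a site of the
discrete arc `A` by a path of edges that are open in the completed configuration
`E.bcBondConfig ω` (arc-`A` edges open, `ω`-open edges off the arc `B`). This is the first step of
Smirnov's a priori estimate (Ann. Math. 172 (2010), Appendix A, proof of Lemma A.1 — arXiv
numbering Lemma 6.1: "if an edge `e` belongs to the interface, then `B` is connected by a
cluster to the arc `ba`"), here for H21's interface = the cut orbit of the successor map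
(`MedialInterfaceProofs`). [cite: Smirnov2010, Appendix A, proof of Lemma A.1] -/
theorem exists_reachable_zdArcA_of_mem_fkInterface (hE : E.IsZdAdmissible) {z : MedialVertex}
    (hz : z ∈ fkInterface E ω) :
    ∃ v ∈ z, ∃ a ∈ E.zdArcA, (Percolation.openGraph (E.bcBondConfig ω)).Reachable v a := by
  classical
  obtain ⟨c₀, hc₀, -⟩ := DiscreteDobrushin.existsUnique_startCorner hE
  have hc₀' : E.IsStartCorner c₀ := ⟨hc₀.1, hc₀.2.1, hc₀.2.2⟩
  have hex := exists_not_isInnerFace_cornerOrbit (ω := ω) hE hc₀'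
  have hlt : ∀ k < Nat.find hex, E.IsInnerFace (cFace (cornerOrbit (E.bcBondConfig ω) c₀ k)) :=
    fun k hk => not_not.1 (Nat.find_min hex hk)
  have hγ : fkInterface E ω = explorationList (E.bcBondConfig ω) c₀ (Nat.find hex) :=
    (isMedialExploration_medialExploration_holds E hE ω).eq_explorationList hE hc₀'
      (Nat.find_spec hex) hlt
  rw [hγ, explorationList, List.mem_map] at hz
  obtain ⟨i, -, rfl⟩ := hz
  exact ⟨_, Sym2.mem_mk_left _ _, c₀.1, hc₀'.mem_zdArcA,
    (cornerOrbit_fst_reachable (E.bcBondConfig ω) c₀ (Nat.zero_le i)).symm⟩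

/-- **An edge of the FK interface borders a face in the dual cluster of the free arc.** For
admissible Dobrushin data and every configuration `ω`, if the lattice edge `z` lies on the FK
interface `fkInterface E ω`, then `z` is a side of a face `f` (both endpoints of `z` are corners
of `f`; `f` is an inner face of `Ω_δ` unless `z` is one of the two `A`–`B` edges) which is joined
by dual-open dual edges (`dualConfig` of the completed configuration: duals of closed edges) to a
non-inner face `f₀` having a corner on the discrete arc `B` — namely the outer face at the
`A`–`B` edge `e_a`. (Smirnov 2010, Appendix A, proof of Lemma A.1: "… and `W` by a dual cluster
to the arc `ab`".) [cite: Smirnov2010, Appendix A, proof of Lemma A.1] -/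
theorem exists_dualReachable_of_mem_fkInterface (hE : E.IsZdAdmissible) {z : MedialVertex}
    (hz : z ∈ fkInterface E ω) :
    ∃ f f₀ : Site 2, (∀ x ∈ z, IsCorner x f) ∧ (E.IsInnerFace f ∨ z ∈ E.zdABEdges) ∧
      ¬ E.IsInnerFace f₀ ∧ (∃ b ∈ E.zdArcB, IsCorner b f₀) ∧
      (Percolation.openGraph (Percolation.dualConfig (E.bcBondConfig ω))).Reachable f f₀ := by
  classical
  obtain ⟨c₀, hc₀, -⟩ := DiscreteDobrushin.existsUnique_startCorner hE
  have hc₀' : E.IsStartCorner c₀ := ⟨hc₀.1, hc₀.2.1, hc₀.2.2⟩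
  have hex := exists_not_isInnerFace_cornerOrbit (ω := ω) hE hc₀'
  have hlt : ∀ k < Nat.find hex, E.IsInnerFace (cFace (cornerOrbit (E.bcBondConfig ω) c₀ k)) :=
    fun k hk => not_not.1 (Nat.find_min hex hk)
  have hγ : fkInterface E ω = explorationList (E.bcBondConfig ω) c₀ (Nat.find hex) :=
    (isMedialExploration_medialExploration_holds E hE ω).eq_explorationList hE hc₀'
      (Nat.find_spec hex) hlt
  rw [hγ, explorationList, List.mem_map] at hz
  obtain ⟨i, hi, rfl⟩ := hz
  rw [List.mem_range] at hi
  refine ⟨cFace (cornerOrbit (E.bcBondConfig ω) c₀ i), faceAt c₀.1 (c₀.2 + 3),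
    fun x hx => isCorner_of_mem_cSrc (Or.inl rfl) hx, ?_, hc₀'.isOutEdge.2,
    ⟨_, hc₀'.mem_zdArcB, (isCorner_add_faceAt_iff _ _ _).2 (Or.inr rfl)⟩,
    (reachable_outerFace_cFace_cornerOrbit hE hc₀' i).symm⟩
  -- inner face, except at the last medial vertex `e_b`
  rcases Nat.lt_succ_iff_lt_or_eq.1 hi with h | rfl
  · exact Or.inl (hlt i h)
  · right
    have hN0 : Nat.find hex ≠ 0 := by
      intro h0
      have h := Nat.find_spec hex
      rw [h0, cornerOrbit_zero] at h
      exact h hc₀'.isOutEdge.1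
    obtain ⟨M, hM⟩ := Nat.exists_eq_succ_of_ne_zero hN0
    have hin : E.IsInnerFace (cFace (cornerOrbit (E.bcBondConfig ω) c₀ M)) := hlt M (by omega)
    have hout : ¬ E.IsInnerFace (cFace (cornerOrbit (E.bcBondConfig ω) c₀ (M + 1))) := by
      have h := Nat.find_spec hex
      rwa [hM] at h
    rw [hM, cSrc_cornerOrbit_succ]
    exact cTgt_exit_mem_zdABEdges hE hc₀' hin hout

end Arms

end Literature.Probability.LatticeModels
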